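import Summits.CriticalPhenomena.PercolationContinuityZ3.Theorems.PercNearOneGluingNoHeavyLowerTailSunflowerC1RegionCertificate
import HarnessLib

/-!
# `NoHeavyLowerTail` (crux stmt-CriticalPhenomena-4575), abstract sunflower cubic at LAW level: the CANONICAL GLADKOV SPLITTING as a
# data-free certificate generator for (C1) — one `native_decide` per structure, no certificate tables

Support file (seat `prim-ineq-gen-2` gen 33; `--supports stmt-CriticalPhenomena-4575`).  No `sorry`, no named facts, standard axioms (the functions
below are HEURISTICS that PROPOSE a certificate; soundness is entirely `C1Cert.c1_of_certs` of …SunflowerC1RegionCertificate, which re-verifies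
everything).  Memo: run/shared/lean/prim/prim-ineq-gen-2/GLADKOV-SPLITTING-GEN33.md §2–§3.

THE GLADKOV SPLITTING (memo §2).  For a sunflower `F` let `g(β) ≥ 0` be the scaled tensor-Bernstein coefficients of `AG = ab − e₂(c)` (degree 2;
`β ∈ {0,1,2}^n`; = the antipodal Gladkov slack of the interval sub-cube `Q_β`).  For a set `𝓑` of such fibres put `AG_𝓑 := Σ_{β∈𝓑} g(β)·x^β(1−x)^{2−β}`.
If `LA − (a−b)·AG_𝓑` has nonnegative Bernstein coefficients then (C1) holds on both sides (`LA = M + (a−b)AG_𝓑`, `LB = M + (b−a)AG_{𝓑ᶜ}`): this is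
exactly a pair of Bernstein region certificates with `S₁ = AG_𝓑` (A-side), `S₁' = AG_{𝓑ᶜ}` (B-side), `S₂ = 0`, `N = 1`.  CONJECTURE (memo §2): such a
`𝓑` always exists; verified by LP on all 146 / 382 three-petal classes on 4 / 5 coins, 400 random + all 1 212 non-AD 3-state-block structures on 6 coins,
the doubled star, and the cyclic star CS(3,3,3) on 9 coins.
THE CANONICAL RULE (memo §3; valid on every structure tested, n ≤ 6): `β ∈ 𝓑` iff the restriction `F|Q_β` is [AD-B and not AD-A] or [neither, with more core
than bottom points in `Q_β`].  AD-A / AD-B of `F|Q_β` are read off the Bernstein coefficient tables of `LA` / `LB` of `F` itself (the fibres `α` with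
`α = 3` on `{β = 2}` and `α = 0` on `{β = 0}`).
* `agBern`, `laBernA`, `lbBernA` — Bernstein coefficient tables of `AG`, `LA`, `LB` (`Bern.bernCoeffsA`);
* `canonInB F laB lbB β : Bool` — the rule; `splitS1 F … inB` — the monomial table of `AG_𝓑` (`Bern.backLA` of the masked `g`);
* `checkSplit F : Bool` — the two `certSide` checks with the canonical `S₁`, `S₁'`;  **`c1_of_checkSplit`**: `checkSplit F = true ⟹` (C1) for `F` at
  every bias.  Usage: `theorem foo : checkSplit F = true := by native_decide` (proposed `--computational`), then `c1_of_checkSplit F foo`.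
-/

namespace Summit.CriticalPhenomena.PercolationContinuityZ3.Theorems.SunflowerPartition

namespace SafeCalc

namespace C1Cert

open Finset Bern

variable {n : ℕ}

/-- The all-zero coefficient table of degree `d`. [this work] -/
def zeroArr (n d : ℕ) : Array ℤ := tabulate (0 : Poly n d)

/-- Table of a product of two tabulated multi-affine factors (degree `2`). [this work] -/
def prod2 (A B : Array ℤ) : Array ℤ := tabulate (mulFast (ofTable n 1 A) (ofTable n 1 B))

/-- Scaled tensor-Bernstein coefficients `g(β)` of `AG = ab − (c₁c₂ + c₁c₃ + c₂c₃)` (the antipodal Gladkov slacks of the sub-cubes). [this work] -/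
def agBern (F : Sunflower (Fin n)) : Array ℤ :=
  let a := cellA F 4
  let b := cellA F 0
  let c1 := cellA F 1
  let c2 := cellA F 2
  let c3 := cellA F 3
  let ab := prod2 (n := n) a b
  let t12 := prod2 (n := n) c1 c2
  let t13 := prod2 (n := n) c1 c3
  let t23 := prod2 (n := n) c2 c3
  bernCoeffsA n 2 (tabulate (ofTable n 2 ab - ofTable n 2 t12 - ofTable n 2 t13 - ofTable n 2 t23))

/-- A 3-fibre `α` belongs to the sub-cube of the 2-fibre `β` (all three points in `Q_β`). [this work] -/
def compat (β : Expo n 2) (α : Expo n 3) : Bool :=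
  decide (∀ i : Fin n, ((β i : ℕ) = 2 → (α i : ℕ) = 3) ∧ ((β i : ℕ) = 0 → (α i : ℕ) = 0))

/-- `F|Q_β` is additively dominated for the given side's coefficient table (all its Bernstein coefficients nonnegative). [this work] -/
def subAD (T : Array ℤ) (β : Expo n 2) : Bool :=
  decide (∀ α : Expo n 3, compat β α = true → 0 ≤ ofTable n 3 T α)

/-- Number of points of `Q_β` with label `ℓ`. [this work] -/
def subCount (F : Sunflower (Fin n)) (β : Expo n 2) (ℓ : Fin 5) : ℕ :=
  #(univ.filter fun S : Finset (Fin n) =>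
    (∀ i : Fin n, ((β i : ℕ) = 2 → i ∈ S) ∧ ((β i : ℕ) = 0 → i ∉ S)) ∧ F.lab S = ℓ)

/-- THE CANONICAL RULE: is `β` a B-fibre?  (`laB`, `lbB` = Bernstein tables of `LA`, `LB`.) [this work] -/
def canonInB (F : Sunflower (Fin n)) (laB lbB : Array ℤ) (β : Expo n 2) : Bool :=
  let adA := subAD (n := n) laB β
  let adB := subAD (n := n) lbB β
  if adB && !adA then true
  else if adA then false
  else decide (subCount F β 0 < subCount F β 4)

/-- Monomial table of `AG_𝓑 = Σ_{β ∈ 𝓑} g(β) x^β (1−x)^{2−β}` for the mask `inB` (backward Bernstein transform of the masked `g`). [this work] -/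
def splitS1 (n : ℕ) (g : Array ℤ) (inB : Expo n 2 → Bool) : Array ℤ :=
  backLA n 2 (List.finRange n) (tabulate (d := 2) fun β => if inB β then ofTable n 2 g β else 0)

/-- **The data-free (C1) check**: the two Bernstein region certificates proposed by the canonical Gladkov splitting. [this work] -/
def checkSplit (F : Sunflower (Fin n)) : Bool :=
  let laT := laArr F
  let lbT := lbArr F
  let laB := bernCoeffsA n 3 laT
  let lbB := bernCoeffsA n 3 lbT
  let g := agBern F
  let inB := canonInB F laB lbB
  let s1A := splitS1 n g inB
  let s1B := splitS1 n g (fun β => !inB β)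
  certSide n laT (dArr F) 1 s1A (zeroArr n 1) && certSide n lbT (ndArr F) 1 s1B (zeroArr n 1)

/-- **(C1) from the canonical splitting check**: if `checkSplit F` evaluates to `true` then `e₃(c) ≤ max(a,b)·(ab − e₂(c))` for the cell
masses of `F` at every bias `x ∈ [0,1]^n`. [this work] -/
theorem c1_of_checkSplit (F : Sunflower (Fin n)) (h : checkSplit F = true) (x : Fin n → ℝ) (hx : ∀ i, 0 ≤ x i ∧ x i ≤ 1) :
    cellMass F 1 x * cellMass F 2 x * cellMass F 3 x ≤
      max (cellMass F 4 x) (cellMass F 0 x) *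
        (cellMass F 4 x * cellMass F 0 x
          - (cellMass F 1 x * cellMass F 2 x + cellMass F 1 x * cellMass F 3 x + cellMass F 2 x * cellMass F 3 x)) := by
  simp only [checkSplit, Bool.and_eq_true] at h
  exact c1_of_certs F h.1 h.2 x hx

end C1Cert

end SafeCalc

end Summit.CriticalPhenomena.PercolationContinuityZ3.Theorems.SunflowerPartition
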